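import Summits.HubbardSuperconductivity.HubbardSuperconductivity.Theorems.AposterioriCapRgSsbToEvenTorusLroPairTransferRung
import Summits.HubbardSuperconductivity.HubbardSuperconductivity.Theorems.WcbcsSsbToTorusLRO.Negative.SummitMatrixUniformFloor
import Summits.HubbardSuperconductivity.HubbardSuperconductivity.Theorems.BalabanIRBirGappedPhaseReductionThermal
import Summits.HubbardSuperconductivity.HubbardSuperconductivity.Theorems.BalabanIRBirEveryGroundStateAffine
import Summits.HubbardSuperconductivity.HubbardSuperconductivity.Theorems.TwTipContinuation.Negative.TipNormalForm

/-!
# Crux `JmPairBridge` (stmt-HubbardSuperconductivity-2226), line `Sketch` — stub `stub_pairBridgeAt_of_floors`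

Route `JosephsonMirror`, crux `JmPairBridge` (thesis X: the every-ground-state Penrose–Onsager pair bridge
between the `(N_L, S^z = 0)` and `(N_L − 2, S^z = 0)` ground floors of `hubbardTorus 2 L 1 U`). This file
is the TRANSFER stub of the lead skeleton (line `Sketch`, card `pair-sum-rule-concentration`): at a point
`(U, δ)`, `0 < δ < 1/2`, the abstract spectral-concentration step (hypothesis `hSC`), the uniform LRO floor
`a L⁴ ≤ ‖Δ_dφ‖²`, the sector gap floor `L²γ_L → ∞` on `(N_L − 2, 0)` and the convexity floor
`e(N_L+2) + e(N_L−2) − 2e(N_L) ≥ −C/L²` give the bridge with constant `a/2`.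

Proof: for a unit ground state `φ` of `(N_L, 0)` put `v = Δ_dφ ∈ (N_L − 2, 0)`. The landed two-sided
Koma–Tasaki transfer inequality `Theorems.stub_pairTransferRung` (at `m = N_L − 2`, window weight
`(1 − δ)/2`) bounds `x + y ≤ C_R L² + max(0, 2e(N_L) − e(N_L−2) − e(N_L+2)) ‖v‖²` with
`x = Re⟨v,Hv⟩ − e(N_L−2)‖v‖²` and `y = Re⟨Δ_dᴴφ, HΔ_dᴴφ⟩ − e(N_L+2)‖Δ_dᴴφ‖² ≥ 0` (variational principle
in `(N_L + 2, 0)`); the convexity floor and the a-priori bound `‖v‖² ≤ C_d L⁴` give `x ≤ C'' L²`; the gap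
floor with constant `2C''/a + 1` and `hSC` give a unit ground state `χ` of `(N_L − 2, 0)` with
`|⟨χ, v⟩|² ≥ ‖v‖² − (a/2)L⁴ ≥ (a/2) L⁴`.

Sources: T. Koma, H. Tasaki, J. Stat. Phys. 76 (1994) 745, Thm 2.2 (double-commutator method);
H. Tasaki, H. Watanabe (2021), arXiv:2105.10692 (own-bottom identity / charge gap); C. Eckart, Phys. Rev.
36 (1930) 878 (capture). No definition, no named fact.
-/

noncomputable section

-- the mandated namespace `Summit.<Summit>.<Problem>.Theorems` repeats `HubbardSuperconductivity`
-- (single-problem summit, D-0017), which the `dupNamespace` linter flags on every declaration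
set_option linter.dupNamespace false

namespace Summit.HubbardSuperconductivity.HubbardSuperconductivity.Theorems.JosephsonMirror

open Matrix Literature.MathematicalPhysics.QuantumLattice Literature.Probability.LatticeModels
open Summit.HubbardSuperconductivity.WcbcsSsbToTorusLRO.Negative (exists_unit_groundStateInSector
  halfFilling_floor_le_sq)
open Summit.HubbardSuperconductivity.TwTipContinuation.Negative (expect_pairIntensity_le)
open scoped ComplexOrder

/-- Real endgame of the transfer: from `γ (S − p) ≤ x`, `x ≤ C'' L²`, `γ = C_g / L²` with
`C'' ≤ (a/2) C_g`, `C_g > 0`, `L² > 0` and `a L⁴ ≤ S` conclude `(a/2) L⁴ ≤ p`. [folklore] -/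
theorem pbf_real_endgame {S p x C'' Cg a L2 : ℝ} (hconc : Cg / L2 * (S - p) ≤ x) (hx : x ≤ C'' * L2)
    (hCg : 0 < Cg) (hL2 : 0 < L2) (hC : C'' ≤ a / 2 * Cg) (hS : a * L2 ^ 2 ≤ S) :
    a / 2 * L2 ^ 2 ≤ p := by
  have h1 : Cg * (S - p) ≤ C'' * L2 * L2 := by
    have := mul_le_mul_of_nonneg_right (hconc.trans hx) hL2.le
    rwa [div_mul_eq_mul_div, div_mul_cancel₀ _ hL2.ne'] at this
  have h2 : C'' * L2 * L2 ≤ a / 2 * Cg * L2 * L2 := by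
    have := mul_le_mul_of_nonneg_right (mul_le_mul_of_nonneg_right hC hL2.le) hL2.le
    linarith
  have h3 : Cg * (S - p) ≤ Cg * (a / 2 * L2 ^ 2) := by nlinarith
  have h4 : S - p ≤ a / 2 * L2 ^ 2 := le_of_mul_le_mul_left h3 hCg
  nlinarith

/-- **`stub_pairBridgeAt_of_floors`** (transfer stub of line `Sketch`, crux `JmPairBridge`). At
`0 < δ < 1/2`: the abstract spectral concentration `hSC`, the uniform every-ground-state LRO floor
`a L⁴ ≤ ‖Δ_d φ‖²` (`hLRO`), the sector gap floor `L² γ_L → ∞` on `(N_L − 2, S^z = 0)` (`hGap`) and the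
charge-gap convexity floor (`hConv`) imply the pair bridge at `(U, δ)`: eventually in even `L`, every unit
ground state `φ` of `hubbardTorus 2 L 1 U` in `(N_L, 0)` has a unit ground state `χ` of `(N_L − 2, 0)` with
`(a/2) L⁴ ≤ |⟨χ, Δ_d φ⟩|²`. Koma–Tasaki (1994) Thm 2.2; Tasaki–Watanabe (2021); Eckart (1930). [folklore] -/
theorem stub_pairBridgeAt_of_floors
    (hSC : ∀ (n : Type) [Fintype n] [DecidableEq n]
      (H : Matrix n n ℂ) (K : Submodule ℂ (n → ℂ)) (γ : ℝ) (v : n → ℂ),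
      H.IsHermitian → (∀ w ∈ K, H *ᵥ w ∈ K) → K ≠ ⊥ → 0 < γ →
      (∀ w ∈ K, (∀ χ ∈ K, H *ᵥ χ = ((H.minEnergyOn K : ℝ) : ℂ) • χ → star χ ⬝ᵥ w = 0) →
        (H.minEnergyOn K + γ) * (star w ⬝ᵥ w).re ≤ (star w ⬝ᵥ H *ᵥ w).re) →
      v ∈ K →
      ∃ χ ∈ K, star χ ⬝ᵥ χ = 1 ∧ H *ᵥ χ = ((H.minEnergyOn K : ℝ) : ℂ) • χ ∧
        γ * ((star v ⬝ᵥ v).re - ‖star χ ⬝ᵥ v‖ ^ 2) ≤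
          (star v ⬝ᵥ H *ᵥ v).re - H.minEnergyOn K * (star v ⬝ᵥ v).re)
    (U δ : ℝ) (hδ : δ ∈ Set.Ioo (0 : ℝ) (1 / 2))
    (hLRO : ∃ a : ℝ, 0 < a ∧ ∃ L₀ : ℕ, ∀ (L : ℕ) [NeZero L], Even L → L₀ ≤ L →
      ∀ φ : Fock (Orb (FermionTorus 2 L)),
        IsGroundStateInSector (hubbardTorus 2 L 1 U) (2 * ⌊(1 - δ) * (L : ℝ) ^ 2 / 2⌋₊) 0 φ →
          star φ ⬝ᵥ φ = 1 →
            a * (L : ℝ) ^ 4 ≤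
              (star (pairField dWaveFormFactor L *ᵥ φ) ⬝ᵥ (pairField dWaveFormFactor L *ᵥ φ)).re)
    (hGap : ∀ C : ℝ, ∃ L₀ : ℕ, ∀ (L : ℕ), Even L → L₀ ≤ L →
      ∀ v : Fock (Orb (FermionTorus 2 L)),
        v ∈ szSector (Λ := FermionTorus 2 L) (2 * ⌊(1 - δ) * (L : ℝ) ^ 2 / 2⌋₊ - 2) 0 →
          (∀ χ : Fock (Orb (FermionTorus 2 L)),
              IsGroundStateInSector (hubbardTorus 2 L 1 U) (2 * ⌊(1 - δ) * (L : ℝ) ^ 2 / 2⌋₊ - 2) 0 χ →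
                star χ ⬝ᵥ v = 0) →
            ((hubbardTorus 2 L 1 U).minEnergyOn
                  (szSector (Λ := FermionTorus 2 L) (2 * ⌊(1 - δ) * (L : ℝ) ^ 2 / 2⌋₊ - 2) 0) +
                C / (L : ℝ) ^ 2) * (star v ⬝ᵥ v).re ≤
              (star v ⬝ᵥ hubbardTorus 2 L 1 U *ᵥ v).re)
    (hConv : ∃ C : ℝ, ∃ L₀ : ℕ, ∀ (L : ℕ), Even L → L₀ ≤ L →
      -C / (L : ℝ) ^ 2 ≤
        (hubbardTorus 2 L 1 U).minEnergyOn
            (szSector (Λ := FermionTorus 2 L) (2 * ⌊(1 - δ) * (L : ℝ) ^ 2 / 2⌋₊ + 2) 0) +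
          (hubbardTorus 2 L 1 U).minEnergyOn
            (szSector (Λ := FermionTorus 2 L) (2 * ⌊(1 - δ) * (L : ℝ) ^ 2 / 2⌋₊ - 2) 0) -
          2 * (hubbardTorus 2 L 1 U).minEnergyOn
            (szSector (Λ := FermionTorus 2 L) (2 * ⌊(1 - δ) * (L : ℝ) ^ 2 / 2⌋₊) 0)) :
    ∃ a : ℝ, 0 < a ∧ ∃ L₀ : ℕ, ∀ (L : ℕ) [NeZero L], Even L → L₀ ≤ L →
      ∀ φ : Fock (Orb (FermionTorus 2 L)),
        IsGroundStateInSector (hubbardTorus 2 L 1 U) (2 * ⌊(1 - δ) * (L : ℝ) ^ 2 / 2⌋₊) 0 φ →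
          star φ ⬝ᵥ φ = 1 →
            ∃ χ : Fock (Orb (FermionTorus 2 L)),
              IsGroundStateInSector (hubbardTorus 2 L 1 U) (2 * ⌊(1 - δ) * (L : ℝ) ^ 2 / 2⌋₊ - 2) 0 χ ∧
                star χ ⬝ᵥ χ = 1 ∧
                  a * (L : ℝ) ^ 4 ≤ ‖star χ ⬝ᵥ Matrix.mulVec (pairField dWaveFormFactor L) φ‖ ^ 2 := by
  classical
  obtain ⟨hδ0, hδ1⟩ := hδ
  obtain ⟨a, ha, L₁, hlro⟩ := hLRO
  obtain ⟨C₁, L₂, hconv⟩ := hConv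
  -- the landed rung, at window weight `(1 - δ)/2`
  have haw : 0 < (1 - δ) / 2 := by linarith
  obtain ⟨CR, hR⟩ := Theorems.stub_pairTransferRung U ((1 - δ) / 2) haw
  -- constants
  set Cd : ℝ := (∑ e ∈ insert 0 unitSteps, ‖((dWaveFormFactor e / Real.sqrt 2 : ℝ) : ℂ)‖ * 2) ^ 2 with hCd
  have hCd0 : 0 ≤ Cd := by positivity
  set C'' : ℝ := max CR 0 + max C₁ 0 * Cd with hC''
  have hC''0 : 0 ≤ C'' := by positivity
  set Cg : ℝ := 2 * C'' / a + 1 with hCg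
  have hCg0 : 0 < Cg := by positivity
  have hCle : C'' ≤ a / 2 * Cg := by
    rw [hCg]
    have : a / 2 * (2 * C'' / a + 1) = C'' + a / 2 := by field_simp
    rw [this]
    linarith
  obtain ⟨L₃, hgap⟩ := hGap Cg
  refine ⟨a / 2, by positivity, max (max L₁ L₂) (max L₃ 4), fun L _ hL hL₀ φ hφ hφ1 => ?_⟩
  have hL₁ : L₁ ≤ L := le_trans (le_max_left _ _) ((le_max_left _ _).trans hL₀)
  have hL₂ : L₂ ≤ L := le_trans (le_max_right _ _) ((le_max_left _ _).trans hL₀)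
  have hL₃ : L₃ ≤ L := le_trans (le_max_left _ _) ((le_max_right _ _).trans hL₀)
  have hL4 : 4 ≤ L := le_trans (le_max_right _ _) ((le_max_right _ _).trans hL₀)
  -- sizes
  have hLr : (4 : ℝ) ≤ (L : ℝ) := by exact_mod_cast hL4
  have hL2pos : (0 : ℝ) < (L : ℝ) ^ 2 := by positivity
  have hL16 : (16 : ℝ) ≤ (L : ℝ) ^ 2 := by nlinarith
  set y : ℝ := (1 - δ) * (L : ℝ) ^ 2 / 2 with hy
  have hy0 : 0 ≤ y := by rw [hy]; exact div_nonneg (mul_nonneg (by linarith) hL2pos.le) (by norm_num)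
  set n₀ : ℕ := ⌊(1 - δ) * (L : ℝ) ^ 2 / 2⌋₊ with hn₀
  have hn₀le : (n₀ : ℝ) ≤ y := Nat.floor_le hy0
  have hn₀gt : y < (n₀ : ℝ) + 1 := Nat.lt_floor_add_one y
  have hy4 : (4 : ℝ) < y := by rw [hy]; nlinarith
  have hn₀1 : 1 ≤ n₀ := by
    have : (3 : ℝ) < (n₀ : ℝ) := by linarith
    exact_mod_cast (show (1 : ℝ) ≤ n₀ by linarith)
  set N : ℕ := 2 * n₀ with hN
  set m : ℕ := N - 2 with hm
  have hNm : m + 2 = N := by omega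
  have hm2 : m = 2 * (n₀ - 1) := by omega
  have hm4 : m + 4 = N + 2 := by omega
  have hmr : (m : ℝ) = 2 * (n₀ : ℝ) - 2 := by
    have : ((m + 2 : ℕ) : ℝ) = ((2 * n₀ : ℕ) : ℝ) := by rw [hNm]
    push_cast at this
    linarith
  -- the window inequalities of the rung
  have hw1 : (1 - δ) / 2 * (L : ℝ) ^ 2 ≤ (m : ℝ) := by rw [hmr]; nlinarith
  have hw2 : (m : ℝ) + 4 ≤ (2 - (1 - δ) / 2) * (L : ℝ) ^ 2 := by rw [hmr]; nlinarith
  -- the Hamiltonian, the pair field, the sector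
  set H := hubbardTorus 2 L 1 U with hH
  set P := pairField dWaveFormFactor L with hP
  have hHerm : H.IsHermitian := LiebThm1.hamiltonian_isHermitian (fermionTorusGraph 2 L) 1 U
  have hφ' : IsGroundStateInSector H (m + 2) 0 φ := by rw [hNm]; exact hφ
  obtain ⟨hvK, hwK, hxy, -, -, -⟩ := hR L m φ hw1 hw2 hφ' hφ1
  set K : Submodule ℂ (Fock (Orb (FermionTorus 2 L))) := szSector (Λ := FermionTorus 2 L) m 0 with hK
  set v := P *ᵥ φ with hv
  -- `H` preserves `K`, `K ≠ ⊥`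
  have hHK : ∀ w ∈ K, H *ᵥ w ∈ K := by
    intro w hw
    rw [hK, hm2] at hw ⊢
    exact hubbardTorus_mulVec_mem_szSector 2 L 1 U (n₀ - 1) hw
  have hKne : K ≠ ⊥ := by
    have hle : n₀ - 1 ≤ L ^ 2 := (Nat.sub_le _ _).trans (halfFilling_floor_le_sq L hδ0.le)
    obtain ⟨ψ₀, hψ₀1, hψ₀K, hψ₀0, -⟩ := exists_unit_groundStateInSector L U hle
    rw [← hm2] at hψ₀K
    intro hbot
    rw [hK] at hbot
    rw [hbot, Submodule.mem_bot] at hψ₀K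
    exact hψ₀0 hψ₀K
  -- the gap hypothesis in the abstract form
  set γ : ℝ := Cg / (L : ℝ) ^ 2 with hγ
  have hγ0 : 0 < γ := div_pos hCg0 hL2pos
  have hgap' : ∀ w ∈ K, (∀ χ ∈ K, H *ᵥ χ = ((H.minEnergyOn K : ℝ) : ℂ) • χ → star χ ⬝ᵥ w = 0) →
      (H.minEnergyOn K + γ) * (star w ⬝ᵥ w).re ≤ (star w ⬝ᵥ H *ᵥ w).re := by
    intro w hw horth
    have h := hgap L hL hL₃ w hw (fun χ hχ => horth χ hχ.1 hχ.2.2)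
    exact h
  -- spectral concentration
  obtain ⟨χ, hχK, hχ1, hχE, hconc⟩ :=
    hSC (Finset (Orb (FermionTorus 2 L))) H K γ v hHerm hHK hKne hγ0 hgap' hvK
  -- the first moment `x ≤ C'' L²`
  have hGram : star φ ⬝ᵥ ((Pᴴ * P) *ᵥ φ) = star v ⬝ᵥ v := by
    rw [hv, Literature.MathematicalPhysics.QuantumLattice.star_mulVec_dotProduct_mulVec]
  have hGram' : star φ ⬝ᵥ ((P * Pᴴ) *ᵥ φ) = star (Pᴴ *ᵥ φ) ⬝ᵥ (Pᴴ *ᵥ φ) := by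
    rw [Literature.MathematicalPhysics.QuantumLattice.star_mulVec_dotProduct_mulVec,
      conjTranspose_conjTranspose]
  have hS0 : 0 ≤ (star v ⬝ᵥ v).re := EigenvalueContinuation.re_star_dotProduct_self_nonneg v
  have hSle : (star v ⬝ᵥ v).re ≤ Cd * (L : ℝ) ^ 4 := by
    have h := expect_pairIntensity_le L φ hφ1
    simp only [expect] at h
    rw [hGram] at h
    simpa [hCd] using h
  have hy' : 0 ≤ (star (Pᴴ *ᵥ φ) ⬝ᵥ H *ᵥ (Pᴴ *ᵥ φ)).re -
      H.minEnergyOn (szSector (Λ := FermionTorus 2 L) (m + 4) 0) * (star (Pᴴ *ᵥ φ) ⬝ᵥ (Pᴴ *ᵥ φ)).re := by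
    have := minEnergyOn_mul_re_le H (szSector (Λ := FermionTorus 2 L) (m + 4) 0) hwK
    linarith
  have hconvL : 2 * H.minEnergyOn (szSector (Λ := FermionTorus 2 L) (m + 2) 0) -
      H.minEnergyOn (szSector (Λ := FermionTorus 2 L) m 0) -
      H.minEnergyOn (szSector (Λ := FermionTorus 2 L) (m + 4) 0) ≤ max C₁ 0 / (L : ℝ) ^ 2 := by
    have h := hconv L hL hL₂
    rw [hm4, hNm]
    have h1 : -C₁ / (L : ℝ) ^ 2 ≥ -(max C₁ 0 / (L : ℝ) ^ 2) := by
      rw [neg_div, ge_iff_le, neg_le_neg_iff]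
      exact div_le_div_of_nonneg_right (le_max_left _ _) hL2pos.le
    have h2 : H.minEnergyOn (szSector (Λ := FermionTorus 2 L) (N - 2) 0) =
        H.minEnergyOn (szSector (Λ := FermionTorus 2 L) m 0) := by rw [hm]
    rw [h2] at h
    linarith
  have hmax : max 0 (2 * H.minEnergyOn (szSector (Λ := FermionTorus 2 L) (m + 2) 0) -
      H.minEnergyOn (szSector (Λ := FermionTorus 2 L) m 0) -
      H.minEnergyOn (szSector (Λ := FermionTorus 2 L) (m + 4) 0)) ≤ max C₁ 0 / (L : ℝ) ^ 2 :=
    max_le (div_nonneg (le_max_right _ _) hL2pos.le) hconvL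
  have hx : (star v ⬝ᵥ H *ᵥ v).re - H.minEnergyOn K * (star v ⬝ᵥ v).re ≤ C'' * (L : ℝ) ^ 2 := by
    simp only [expect] at hxy
    rw [hGram, hGram'] at hxy
    have hprod : max 0 (2 * H.minEnergyOn (szSector (Λ := FermionTorus 2 L) (m + 2) 0) -
        H.minEnergyOn (szSector (Λ := FermionTorus 2 L) m 0) -
        H.minEnergyOn (szSector (Λ := FermionTorus 2 L) (m + 4) 0)) * (star v ⬝ᵥ v).re ≤
        max C₁ 0 / (L : ℝ) ^ 2 * (Cd * (L : ℝ) ^ 4) :=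
      mul_le_mul hmax hSle hS0 (div_nonneg (le_max_right _ _) hL2pos.le)
    have hsimp : max C₁ 0 / (L : ℝ) ^ 2 * (Cd * (L : ℝ) ^ 4) = max C₁ 0 * Cd * (L : ℝ) ^ 2 := by
      field_simp
    rw [hsimp] at hprod
    have hCR : CR * (L : ℝ) ^ 2 ≤ max CR 0 * (L : ℝ) ^ 2 :=
      mul_le_mul_of_nonneg_right (le_max_left _ _) hL2pos.le
    have : C'' * (L : ℝ) ^ 2 = max CR 0 * (L : ℝ) ^ 2 + max C₁ 0 * Cd * (L : ℝ) ^ 2 := by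
      rw [hC'']; ring
    rw [this]
    linarith
  -- the endgame
  have hS : a * ((L : ℝ) ^ 2) ^ 2 ≤ (star v ⬝ᵥ v).re := by
    have h := hlro L hL hL₁ φ hφ hφ1
    rw [← pow_mul]
    exact h
  refine ⟨χ, ⟨hχK, ?_, hχE⟩, hχ1, ?_⟩
  · intro h0
    rw [h0, dotProduct_zero] at hχ1
    exact zero_ne_one hχ1
  · have key := pbf_real_endgame (p := ‖star χ ⬝ᵥ v‖ ^ 2) hconc hx hCg0 hL2pos hCle hS
    rw [← pow_mul] at key
    exact key

end Summit.HubbardSuperconductivity.HubbardSuperconductivity.Theorems.JosephsonMirror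

end
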